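import Mathlib
import Literature.Computability.AlgebraicComplexity.NewtonPolygonTau
import Summits.ValiantsHypothesis.ValiantsHypothesis.Theorems.ElementaryWordLengthWordPerSuperPolyNewtonGeometry

/-!
# Stub S1 `stub_tropicalWordBound` of line `Sketch` (crux `WordPerSuperPoly`,
# stmt-ValiantsHypothesis-6626): the tropical (cancellation-free) word bound

**Statement.** For a sparse bivariate word `w = (E_{i₁j₁}(c₁ x^{a₁} y^{b₁}), …)` of length `L` with
off-diagonal letters and positive real coefficients `cₖ`, the Newton polygon of the `(0, 2)` entry
of the product matrix has at most `6 (L + 1)^3` vertices (`newtonVertexCount`).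

**Cancellation-free bookkeeping.** A bivariate polynomial over `ℂ` is *coefficientwise
nonnegative* if every coefficient is a nonnegative real (`0 ≤ coeff m f` in the scoped order
`ComplexOrder`).  Such polynomials are closed under sums and products, and their supports behave
tropically: `supp (f + g) = supp f ∪ supp g`, `supp (f g) = supp f + supp g` (a sum of nonnegative
reals with a positive term is positive).  Every entry of the matrix of a positive word is
coefficientwise nonnegative (`coeff_nonneg_wordProd`), so the support of an entry of `M_u M_{u'}`
is `⋃_r (supp M_u(p, r) + supp M_{u'}(r, q))` (`support_mul_apply_eq`); a word of length `≤ 1`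
has monomial entries.

**Geometry and recursion.** For a sign `σ` count the `σ`-exposed support points (strict
maximisers of `t·x + σ·y` for some `t`): this count is subadditive under union and under Minkowski
sum in the plane (`ncard_exposed_union_le`, `ncard_exposed_add_le`, file
`ElementaryWordLengthWordPerSuperPolyNewtonGeometry`), hence at most `6^j` for words of length
`≤ 2^j` by halving (`ncard_expo_wordProd_le`).  Every hull vertex is `1`- or `(-1)`-exposed
(`ncard_extremePoints_convexHull_le`), so with `j = ⌈log₂ L⌉` the vertex count is at most
`2 · 6^j ≤ 6 (L + 1)^3` (`two_mul_six_pow_clog_le`).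

No definitions are introduced: the matrix of a word, the lattice points of a support and the
exposed points are local notations for the written-out terms (the first verbatim the skeleton's
`sparseEntry⟦w⟧` without the final `0 2`).
-/

-- `Summit.ValiantsHypothesis.ValiantsHypothesis.…` is the tree's mandated single-conjunct layout.
set_option linter.dupNamespace false

namespace Summit.ValiantsHypothesis.ValiantsHypothesis.Theorems.ElementaryWordLengthWordPerSuperPoly

open MvPolynomial Literature.Computability.AlgebraicComplexity
open scoped ComplexOrder Pointwise

/-- `wordMat⟦w⟧` (local notation, not a definition): the matrix of a sparse bivariate word,
letters `(i, j, c, (a, b)) ↦ E_{ij}(c · x^a y^b)`, verbatim the skeleton's `sparseEntry⟦w⟧`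
without the final `0 2`. -/
local notation3 (prettyPrint := false) "wordMat⟦" w "⟧" =>
  List.prod (List.map (fun l : Fin 3 × Fin 3 × ℂ × (ℕ × ℕ) =>
    Matrix.transvection l.1 l.2.1
      (MvPolynomial.C l.2.2.1 * (MvPolynomial.X 0 ^ l.2.2.2.1 * MvPolynomial.X 1 ^ l.2.2.2.2) :
        MvPolynomial (Fin 2) ℂ)) w)

/-- `pts⟦s⟧` (local notation): the lattice points of a set of exponents, cast into `ℝ²` exactly
as in `newtonVertexCount`. -/
local notation3 (prettyPrint := false) "pts⟦" s "⟧" =>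
  (fun e : Fin 2 →₀ ℕ => fun i : Fin 2 => ((e i : ℕ) : ℝ)) '' (s : Set (Fin 2 →₀ ℕ))

/-- `expo⟦σ, A⟧` (local notation): the `σ`-exposed points of `A ⊆ ℝ²` — those `p ∈ A` at which
some `t·x + σ·y` is strictly maximised over `A`. -/
local notation3 (prettyPrint := false) "expo⟦" σ ", " A "⟧" =>
  {p : Fin 2 → ℝ | p ∈ A ∧ ∃ t : ℝ, ∀ q ∈ A, q ≠ p → t * q 0 + σ * q 1 < t * p 0 + σ * p 1}

/-! ## Coefficientwise nonnegative polynomials -/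

/-- `0` is coefficientwise nonnegative. [folklore] -/
theorem coeff_nonneg_zero : ∀ m, (0 : ℂ) ≤ coeff m (0 : MvPolynomial (Fin 2) ℂ) := fun m => by
  simp

/-- `1` is coefficientwise nonnegative. [folklore] -/
theorem coeff_nonneg_one : ∀ m, (0 : ℂ) ≤ coeff m (1 : MvPolynomial (Fin 2) ℂ) := fun m => by
  classical
  rw [coeff_one]
  split_ifs
  · exact zero_le_one
  · exact le_rfl

/-- A monomial with a nonnegative real coefficient is coefficientwise nonnegative. [folklore] -/
theorem coeff_nonneg_monomial (s : Fin 2 →₀ ℕ) {c : ℂ} (hc : 0 ≤ c) :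
    ∀ m, (0 : ℂ) ≤ coeff m (monomial s c) := fun m => by
  classical
  rw [coeff_monomial]
  split_ifs
  · exact hc
  · exact le_rfl

/-- Sums of coefficientwise nonnegative polynomials are coefficientwise nonnegative. [folklore] -/
theorem coeff_nonneg_add {f g : MvPolynomial (Fin 2) ℂ} (hf : ∀ m, (0 : ℂ) ≤ coeff m f)
    (hg : ∀ m, (0 : ℂ) ≤ coeff m g) : ∀ m, (0 : ℂ) ≤ coeff m (f + g) := fun m => by
  rw [coeff_add]
  exact add_nonneg (hf m) (hg m)

/-- Products of coefficientwise nonnegative polynomials are coefficientwise nonnegative.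
[folklore] -/
theorem coeff_nonneg_mul {f g : MvPolynomial (Fin 2) ℂ} (hf : ∀ m, (0 : ℂ) ≤ coeff m f)
    (hg : ∀ m, (0 : ℂ) ≤ coeff m g) : ∀ m, (0 : ℂ) ≤ coeff m (f * g) := fun m => by
  classical
  rw [coeff_mul]
  exact Finset.sum_nonneg (fun x _ => mul_nonneg (hf _) (hg _))

/-- **No cancellation in sums.** For coefficientwise nonnegative `f, g`:
`supp (f + g) = supp f ∪ supp g`. [folklore] -/
theorem support_add_eq_of_coeff_nonneg {f g : MvPolynomial (Fin 2) ℂ}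
    (hf : ∀ m, (0 : ℂ) ≤ coeff m f) (hg : ∀ m, (0 : ℂ) ≤ coeff m g) :
    (f + g).support = f.support ∪ g.support := by
  classical
  refine Finset.Subset.antisymm support_add (fun m hm => ?_)
  rw [mem_support_iff, coeff_add]
  intro h0
  have h := (add_eq_zero_iff_of_nonneg (hf m) (hg m)).1 h0
  rcases Finset.mem_union.1 hm with hm | hm
  · exact (mem_support_iff.1 hm) h.1
  · exact (mem_support_iff.1 hm) h.2

/-- **No cancellation in products.** For coefficientwise nonnegative `f, g`:
`supp (f g) = supp f + supp g` (Minkowski sum): the coefficient of `x^{a+b}` is a sum of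
nonnegative reals containing the positive term `f_a g_b`. [folklore] -/
theorem support_mul_eq_of_coeff_nonneg {f g : MvPolynomial (Fin 2) ℂ}
    (hf : ∀ m, (0 : ℂ) ≤ coeff m f) (hg : ∀ m, (0 : ℂ) ≤ coeff m g) :
    (f * g).support = f.support + g.support := by
  classical
  refine Finset.Subset.antisymm (support_mul f g) (fun m hm => ?_)
  obtain ⟨a, ha, b, hb, rfl⟩ := Finset.mem_add.1 hm
  rw [mem_support_iff, coeff_mul]
  have hpos : 0 < coeff a f * coeff b g :=
    mul_pos (lt_of_le_of_ne (hf a) (Ne.symm (mem_support_iff.1 ha)))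
      (lt_of_le_of_ne (hg b) (Ne.symm (mem_support_iff.1 hb)))
  have hle := Finset.single_le_sum (s := Finset.HasAntidiagonal.antidiagonal (a + b))
    (f := fun x : (Fin 2 →₀ ℕ) × (Fin 2 →₀ ℕ) => coeff x.1 f * coeff x.2 g)
    (fun x _ => mul_nonneg (hf _) (hg _)) (a := (a, b)) (by simp)
  exact (lt_of_lt_of_le hpos hle).ne'

/-! ## Letters and words -/

/-- A letter `c · xᵃ yᵇ` is the monomial `monomial (a e₀ + b e₁) c`. [folklore] -/
theorem letter_eq_monomial (c : ℂ) (a b : ℕ) :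
    (C c * (X 0 ^ a * X 1 ^ b) : MvPolynomial (Fin 2) ℂ) =
      monomial (Finsupp.single 0 a + Finsupp.single 1 b) c := by
  rw [X_pow_eq_monomial, X_pow_eq_monomial, monomial_mul, C_mul_monomial]
  simp

/-- A letter with a positive real coefficient is coefficientwise nonnegative. [folklore] -/
theorem coeff_nonneg_letter {c : ℂ} (hc : ∃ r : ℝ, 0 < r ∧ c = (r : ℂ)) (a b : ℕ) :
    ∀ m, (0 : ℂ) ≤ coeff m (C c * (X 0 ^ a * X 1 ^ b) : MvPolynomial (Fin 2) ℂ) := by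
  obtain ⟨r, hr, rfl⟩ := hc
  rw [letter_eq_monomial]
  exact coeff_nonneg_monomial _ (Complex.zero_le_real.2 hr.le)

/-- Left multiplication by a transvection `E_{ij}(c)` with coefficientwise nonnegative `c`
preserves coefficientwise nonnegativity of all entries (row `i` becomes `row i + c · row j`).
[folklore] -/
theorem coeff_nonneg_transvection_mul {i j : Fin 3} {c : MvPolynomial (Fin 2) ℂ}
    (hc : ∀ m, (0 : ℂ) ≤ coeff m c) {M : Matrix (Fin 3) (Fin 3) (MvPolynomial (Fin 2) ℂ)}
    (hM : ∀ p q m, (0 : ℂ) ≤ coeff m (M p q)) :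
    ∀ p q m, (0 : ℂ) ≤ coeff m ((Matrix.transvection i j c * M) p q) := by
  intro p q
  by_cases hp : p = i
  · subst hp
    rw [Matrix.transvection_mul_apply_same]
    exact coeff_nonneg_add (hM _ _) (coeff_nonneg_mul hc (hM _ _))
  · rw [Matrix.transvection_mul_apply_of_ne i j p q hp c M]
    exact hM p q

/-- **Positive words are cancellation-free.** Every entry of the matrix of a sparse bivariate word
with positive real letter coefficients is coefficientwise nonnegative. [folklore] -/
theorem coeff_nonneg_wordProd : ∀ (w : List (Fin 3 × Fin 3 × ℂ × (ℕ × ℕ))),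
    (∀ l ∈ w, ∃ r : ℝ, 0 < r ∧ l.2.2.1 = (r : ℂ)) →
    ∀ p q m, (0 : ℂ) ≤ coeff m ((List.prod (List.map (fun l : Fin 3 × Fin 3 × ℂ × (ℕ × ℕ) =>
      Matrix.transvection l.1 l.2.1
        (MvPolynomial.C l.2.2.1 * (MvPolynomial.X 0 ^ l.2.2.2.1 * MvPolynomial.X 1 ^ l.2.2.2.2) :
          MvPolynomial (Fin 2) ℂ)) w)) p q)
  | [], _ => by
    intro p q m
    rw [List.map_nil, List.prod_nil, Matrix.one_apply]
    split_ifs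
    · exact coeff_nonneg_one m
    · exact coeff_nonneg_zero m
  | l :: w, h => by
    rw [List.map_cons, List.prod_cons]
    exact coeff_nonneg_transvection_mul (coeff_nonneg_letter (h l List.mem_cons_self) _ _)
      (coeff_nonneg_wordProd w (fun l' hl' => h l' (List.mem_cons_of_mem _ hl')))

/-- The entries of a single transvection letter `E_{ij}(monomial)` (`i ≠ j`) have at most one
monomial each: they are `0`, `1` or the monomial. [folklore] -/
theorem card_support_transvection_apply_le_one {i j : Fin 3} (hij : i ≠ j) (s : Fin 2 →₀ ℕ)
    (c : ℂ) (p q : Fin 3) :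
    ((Matrix.transvection i j (monomial s c) : Matrix (Fin 3) (Fin 3) (MvPolynomial (Fin 2) ℂ))
      p q).support.card ≤ 1 := by
  classical
  rw [Matrix.transvection, Matrix.add_apply, Matrix.one_apply, Matrix.single_apply]
  by_cases hpq : p = q
  · subst hpq
    have hnot : ¬ (i = p ∧ j = p) := fun h' => hij (h'.1.trans h'.2.symm)
    rw [if_pos rfl, if_neg hnot, add_zero, one_def]
    exact (Finset.card_le_card support_monomial_subset).trans (by simp)
  · rw [if_neg hpq, zero_add]
    split_ifs
    · exact (Finset.card_le_card support_monomial_subset).trans (by simp)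
    · simp

/-- **Words of length `≤ 1` are monomial matrices.** Every entry of the matrix of a sparse
bivariate word of length at most one (with off-diagonal letters) has at most one monomial.
[folklore] -/
theorem card_support_wordProd_le_one_of_length_le_one :
    ∀ (w : List (Fin 3 × Fin 3 × ℂ × (ℕ × ℕ))), (∀ l ∈ w, l.1 ≠ l.2.1) → w.length ≤ 1 →
    ∀ p q, ((List.prod (List.map (fun l : Fin 3 × Fin 3 × ℂ × (ℕ × ℕ) =>
      Matrix.transvection l.1 l.2.1
        (MvPolynomial.C l.2.2.1 * (MvPolynomial.X 0 ^ l.2.2.2.1 * MvPolynomial.X 1 ^ l.2.2.2.2) :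
          MvPolynomial (Fin 2) ℂ)) w)) p q).support.card ≤ 1
  | [], _, _ => by
    classical
    intro p q
    rw [List.map_nil, List.prod_nil, Matrix.one_apply]
    split_ifs
    · rw [one_def]
      exact (Finset.card_le_card support_monomial_subset).trans (by simp)
    · simp
  | [l], hne, _ => by
    intro p q
    rw [List.map_cons, List.map_nil, List.prod_cons, List.prod_nil, mul_one, letter_eq_monomial]
    exact card_support_transvection_apply_le_one (hne l List.mem_cons_self) _ _ p q
  | _ :: _ :: _, _, hlen => by
    simp at hlen

/-- **Tropical support of a product entry.** If all entries of `A` and `B` are coefficientwise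
nonnegative, the support of the `(p, q)` entry of `A * B` is the union over `r` of the Minkowski
sums `supp A p r + supp B r q`. [folklore] -/
theorem support_mul_apply_eq {A B : Matrix (Fin 3) (Fin 3) (MvPolynomial (Fin 2) ℂ)}
    (hA : ∀ p q m, (0 : ℂ) ≤ coeff m (A p q)) (hB : ∀ p q m, (0 : ℂ) ≤ coeff m (B p q))
    (p q : Fin 3) :
    ((A * B) p q).support =
      ((A p 0).support + (B 0 q).support ∪ ((A p 1).support + (B 1 q).support)) ∪
        ((A p 2).support + (B 2 q).support) := by
  rw [Matrix.mul_apply, Fin.sum_univ_three]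
  have h0 := coeff_nonneg_mul (hA p 0) (hB 0 q)
  have h1 := coeff_nonneg_mul (hA p 1) (hB 1 q)
  have h2 := coeff_nonneg_mul (hA p 2) (hB 2 q)
  rw [support_add_eq_of_coeff_nonneg (coeff_nonneg_add h0 h1) h2,
    support_add_eq_of_coeff_nonneg h0 h1, support_mul_eq_of_coeff_nonneg (hA p 0) (hB 0 q),
    support_mul_eq_of_coeff_nonneg (hA p 1) (hB 1 q),
    support_mul_eq_of_coeff_nonneg (hA p 2) (hB 2 q)]

/-! ## Lattice points: finiteness, unions, Minkowski sums -/

/-- The lattice points of a finite exponent set form a finite set. [folklore] -/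
theorem pts_finite (s : Finset (Fin 2 →₀ ℕ)) : (pts⟦(s : Set (Fin 2 →₀ ℕ))⟧).Finite :=
  s.finite_toSet.image _

/-- Lattice points of a union. [folklore] -/
theorem pts_union (s t : Finset (Fin 2 →₀ ℕ)) :
    pts⟦((s ∪ t : Finset (Fin 2 →₀ ℕ)) : Set (Fin 2 →₀ ℕ))⟧ =
      pts⟦(s : Set (Fin 2 →₀ ℕ))⟧ ∪ pts⟦(t : Set (Fin 2 →₀ ℕ))⟧ := by
  rw [Finset.coe_union, Set.image_union]

/-- Lattice points of a Minkowski sum (the cast `ℕ² → ℝ²` is additive). [folklore] -/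
theorem pts_add (s t : Finset (Fin 2 →₀ ℕ)) :
    pts⟦((s + t : Finset (Fin 2 →₀ ℕ)) : Set (Fin 2 →₀ ℕ))⟧ =
      pts⟦(s : Set (Fin 2 →₀ ℕ))⟧ + pts⟦(t : Set (Fin 2 →₀ ℕ))⟧ := by
  rw [Finset.coe_add, ← Set.image2_add, ← Set.image2_add]
  refine Set.image_image2_distrib (fun a b => ?_)
  funext i
  simp

/-- An exponent set with at most one element has at most one exposed lattice point. [folklore] -/
theorem ncard_expo_le_one_of_card_le_one (σ : ℝ) (s : Finset (Fin 2 →₀ ℕ)) (hs : s.card ≤ 1) :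
    (expo⟦σ, pts⟦(s : Set (Fin 2 →₀ ℕ))⟧⟧).ncard ≤ 1 :=
  calc (expo⟦σ, pts⟦(s : Set (Fin 2 →₀ ℕ))⟧⟧).ncard ≤ (pts⟦(s : Set (Fin 2 →₀ ℕ))⟧).ncard :=
        Set.ncard_le_ncard (fun _ hp => hp.1) (pts_finite s)
    _ ≤ (s : Set (Fin 2 →₀ ℕ)).ncard := Set.ncard_image_le s.finite_toSet
    _ = s.card := Set.ncard_coe_finset s
    _ ≤ 1 := hs

/-! ## The halving recursion -/

/-- **Tropical recursion.** For a positive off-diagonal word of length `≤ 2^j`, every entry of its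
matrix has at most `6^j` `σ`-exposed support points: split the word into two halves `u ++ u'`;
the support of `(M_u M_{u'})(p, q)` is `⋃_{r<3} (supp M_u(p,r) + supp M_{u'}(r,q))`, and exposed
points are subadditive under union and Minkowski sum, giving `3 · (6^j + 6^j) = 6^{j+1}`.
[folklore] -/
theorem ncard_expo_wordProd_le (σ : ℝ) : ∀ (j : ℕ) (w : List (Fin 3 × Fin 3 × ℂ × (ℕ × ℕ))),
    (∀ l ∈ w, l.1 ≠ l.2.1) → (∀ l ∈ w, ∃ r : ℝ, 0 < r ∧ l.2.2.1 = (r : ℂ)) → w.length ≤ 2 ^ j →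
    ∀ p q : Fin 3, (expo⟦σ, pts⟦((wordMat⟦w⟧ p q).support : Set (Fin 2 →₀ ℕ))⟧⟧).ncard ≤ 6 ^ j := by
  intro j
  induction j with
  | zero =>
    intro w hne _ hlen p q
    rw [pow_zero] at hlen ⊢
    exact ncard_expo_le_one_of_card_le_one σ _
      (card_support_wordProd_le_one_of_length_le_one w hne hlen p q)
  | succ j ih =>
    intro w hne hpos hlen p q
    obtain ⟨u, u', hw, hulen, hu'len⟩ : ∃ u u' : List (Fin 3 × Fin 3 × ℂ × (ℕ × ℕ)),
        w = u ++ u' ∧ u.length ≤ 2 ^ j ∧ u'.length ≤ 2 ^ j := by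
      refine ⟨w.take (2 ^ j), w.drop (2 ^ j), (List.take_append_drop _ _).symm, ?_, ?_⟩
      · rw [List.length_take]
        exact min_le_left _ _
      · rw [List.length_drop, pow_succ] at *
        omega
    subst hw
    have hune : ∀ l ∈ u, l.1 ≠ l.2.1 := fun l hl => hne l (List.mem_append.2 (Or.inl hl))
    have hu'ne : ∀ l ∈ u', l.1 ≠ l.2.1 := fun l hl => hne l (List.mem_append.2 (Or.inr hl))
    have hupos : ∀ l ∈ u, ∃ r : ℝ, 0 < r ∧ l.2.2.1 = (r : ℂ) :=
      fun l hl => hpos l (List.mem_append.2 (Or.inl hl))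
    have hu'pos : ∀ l ∈ u', ∃ r : ℝ, 0 < r ∧ l.2.2.1 = (r : ℂ) :=
      fun l hl => hpos l (List.mem_append.2 (Or.inr hl))
    have hA := coeff_nonneg_wordProd u hupos
    have hB := coeff_nonneg_wordProd u' hu'pos
    have hAe : ∀ r, (expo⟦σ, pts⟦((wordMat⟦u⟧ p r).support : Set (Fin 2 →₀ ℕ))⟧⟧).ncard ≤ 6 ^ j :=
      fun r => ih u hune hupos hulen p r
    have hBe : ∀ r, (expo⟦σ, pts⟦((wordMat⟦u'⟧ r q).support : Set (Fin 2 →₀ ℕ))⟧⟧).ncard ≤ 6 ^ j :=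
      fun r => ih u' hu'ne hu'pos hu'len r q
    have hfin : ∀ r, (pts⟦((wordMat⟦u⟧ p r).support : Set (Fin 2 →₀ ℕ))⟧ +
        pts⟦((wordMat⟦u'⟧ r q).support : Set (Fin 2 →₀ ℕ))⟧).Finite :=
      fun r => (pts_finite _).add (pts_finite _)
    rw [List.map_append, List.prod_append, support_mul_apply_eq hA hB p q]
    simp only [pts_union, pts_add]
    refine le_trans (ncard_exposed_union_le _ _ ((hfin 0).union (hfin 1)) (hfin 2) σ) ?_
    refine le_trans (add_le_add (ncard_exposed_union_le _ _ (hfin 0) (hfin 1) σ) le_rfl) ?_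
    refine le_trans (add_le_add (add_le_add
      (ncard_exposed_add_le _ _ (pts_finite _) (pts_finite _) σ)
      (ncard_exposed_add_le _ _ (pts_finite _) (pts_finite _) σ))
      (ncard_exposed_add_le _ _ (pts_finite _) (pts_finite _) σ)) ?_
    have h0 := hAe 0; have h1 := hAe 1; have h2 := hAe 2
    have g0 := hBe 0; have g1 := hBe 1; have g2 := hBe 2
    have hp : 6 ^ (j + 1) = 6 ^ j * 6 := pow_succ 6 j
    omega

/-! ## Numerics: `2 · 6^{⌈log₂ L⌉} ≤ 6 (L + 1)^3` -/

/-- `2 · 6^k ≤ 8^k` for `k ≥ 3`. [folklore] -/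
theorem two_mul_six_pow_le_eight_pow (k : ℕ) (hk : 3 ≤ k) : 2 * 6 ^ k ≤ 8 ^ k := by
  induction k, hk using Nat.le_induction with
  | base => norm_num
  | succ k _ ih =>
    calc 2 * 6 ^ (k + 1) = 6 * (2 * 6 ^ k) := by ring
      _ ≤ 6 * 8 ^ k := Nat.mul_le_mul_left 6 ih
      _ ≤ 8 ^ (k + 1) := by rw [pow_succ]; omega

/-- `6^{k+1} ≤ 3 (2^k + 2)^3` for every `k`. [folklore] -/
theorem six_pow_succ_le (k : ℕ) : 6 ^ (k + 1) ≤ 3 * (2 ^ k + 2) ^ 3 := by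
  rcases Nat.lt_or_ge k 3 with hk | hk
  · interval_cases k <;> norm_num
  · have h := two_mul_six_pow_le_eight_pow k hk
    have h8 : (8 : ℕ) ^ k = (2 ^ k) ^ 3 := by
      rw [← pow_mul, mul_comm, pow_mul]
      norm_num
    calc 6 ^ (k + 1) = 3 * (2 * 6 ^ k) := by ring
      _ ≤ 3 * 8 ^ k := Nat.mul_le_mul_left 3 h
      _ = 3 * (2 ^ k) ^ 3 := by rw [h8]
      _ ≤ 3 * (2 ^ k + 2) ^ 3 := by gcongr; omega

/-- With `j = ⌈log₂ L⌉` (`Nat.clog 2 L`): `2 · 6^j ≤ 6 (L + 1)^3`. [folklore] -/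
theorem two_mul_six_pow_clog_le (L : ℕ) : 2 * 6 ^ Nat.clog 2 L ≤ 6 * (L + 1) ^ 3 := by
  rcases Nat.lt_or_ge 1 L with hL | hL
  · have hlt := Nat.pow_pred_clog_lt_self (b := 2) (by norm_num) hL
    obtain ⟨k, hk⟩ : ∃ k, Nat.clog 2 L = k + 1 := by
      refine Nat.exists_eq_add_one.2 (Nat.pos_of_ne_zero fun h0 => ?_)
      have := Nat.le_pow_clog (b := 2) (by norm_num) L
      rw [h0, pow_zero] at this
      omega
    rw [hk] at hlt ⊢
    rw [Nat.pred_succ] at hlt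
    have h1 := six_pow_succ_le k
    have h2 : (2 ^ k + 2) ^ 3 ≤ (L + 1) ^ 3 := Nat.pow_le_pow_left (by omega) 3
    calc 2 * 6 ^ (k + 1) ≤ 2 * (3 * (2 ^ k + 2) ^ 3) := Nat.mul_le_mul_left 2 h1
      _ ≤ 2 * (3 * (L + 1) ^ 3) := by gcongr
      _ = 6 * (L + 1) ^ 3 := by ring
  · rw [Nat.clog_of_right_le_one hL, pow_zero]
    have : 1 ≤ (L + 1) ^ 3 := Nat.one_le_pow _ _ (Nat.succ_pos L)
    omega

/-! ## The stub -/

/-- **S1 (tropical dichotomy lemma).** A sparse bivariate word all of whose letter coefficients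
are positive reals has no cancellation, and the Newton polygon of its `(0,2)` entry has at most
`6 (L+1)^3` vertices: every vertex is an upper- or lower-exposed support point, and for each sign
the exposed support points number at most `6^{⌈log₂ L⌉}` by the halving recursion
`V(L) ≤ 3 · 2 · V(L/2)` along `M[s,t] = Σ_u M[s,u] · M[u,t]`. [folklore] -/
theorem stub_tropicalWordBound :
    ∀ w : List (Fin 3 × Fin 3 × ℂ × (ℕ × ℕ)), (∀ l ∈ w, l.1 ≠ l.2.1) →
      (∀ l ∈ w, ∃ r : ℝ, 0 < r ∧ l.2.2.1 = (r : ℂ)) →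
      newtonVertexCount
        ((w.map (fun l : Fin 3 × Fin 3 × ℂ × (ℕ × ℕ) => Matrix.transvection l.1 l.2.1
          (MvPolynomial.C l.2.2.1 * (MvPolynomial.X 0 ^ l.2.2.2.1 * MvPolynomial.X 1 ^ l.2.2.2.2) :
            MvPolynomial (Fin 2) ℂ))).prod 0 2) ≤ 6 * (w.length + 1) ^ 3 := by
  intro w hne hpos
  have hlen : w.length ≤ 2 ^ Nat.clog 2 w.length := Nat.le_pow_clog (by norm_num) _
  have h1 := ncard_expo_wordProd_le 1 (Nat.clog 2 w.length) w hne hpos hlen 0 2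
  have h2 := ncard_expo_wordProd_le (-1) (Nat.clog 2 w.length) w hne hpos hlen 0 2
  have hgeom := ncard_extremePoints_convexHull_le
    (pts⟦((wordMat⟦w⟧ 0 2).support : Set (Fin 2 →₀ ℕ))⟧) (pts_finite _)
  have hnum := two_mul_six_pow_clog_le w.length
  exact hgeom.trans (by omega)

end Summit.ValiantsHypothesis.ValiantsHypothesis.Theorems.ElementaryWordLengthWordPerSuperPoly
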